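import Literature.NumberTheory.GelbartRogawski1991.LocalDoubledUnitaryLagrangians
import Literature.NumberTheory.GelbartRogawski1991.DoubledUnitaryAdaptedBigCell
import Literature.NumberTheory.Weil1964.LocalLerayCocycleTransport
import Literature.NumberTheory.Weil1964.LocalWeilIndexHermitianRes
import HarnessLib

-- buildfix G11b-3 recipe (LEDGER B13-1/B13-3): elaborate sequentially so the trailing `attribute [implicit_reducible]`
-- block (reducibilityCoreExt is keyed to the async environment branch) is in force at `.olean` export.
set_option Elab.async false

/-!
# The Leray cocycle of `ℓ_Δ` on the big cell of the doubled unitary group is the Weil index of the restriction of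
# scalars of a hermitian form ([Kudla1994, §3]; [HarrisKudlaSweet1996, §1 (1.14)–(1.16)]; [LionVergne1980, §1.5.4])

Topic `NumberTheory/GelbartRogawski1991`; namespace
`Literature.NumberTheory.GelbartRogawski1991.UnitaryDualPair.LocalSplitting` (sequel of
`LocalDoubledUnitaryLagrangians`, `DoubledUnitaryAdaptedBigCell`).  KERNEL only; no named fact, no `sorry`.

For `a, b ∈ H(F_v) = U(𝕍 ⊕ −𝕍)(F_v)` with `a`, `ab` in the big cell `Ω_H` (adapted blocks `C_a`, `C_{ab}` invertible):

* §1 the parametrisation `z ↦ a·(z, z)` of `imDeltaV a` (`paramEquiv`) and the decomposition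
  `a·(z, z) = dblV (W z) + ab·(y, y)`, `y = C_{ab}⁻¹ C_a z`, `W = A_a − A_{ab} C_{ab}⁻¹ C_a` (`param_decomp`);
* §2 `c^{ψ'}_{ℓ_Δ}(ι a, ι b) = μ_{ψ'}(ℓ_Δ, ι(a)ℓ_Δ, ι(ab)ℓ_Δ)` is, through the frame `eD`, the Leray–Weil index of
  `(deltaV, imDeltaV a, imDeltaV (ab))` in `((E ⊗ F_v)^{n ⊕ n}, im h_𝔻)` (`localLeray_val_eq_lerayWeilIndex`);
* §3 in the parametrisation `z ↦ a·(z, z)` the transverse form `x ↦ A(p₁₃ x, p₃₁ x)` of [LionVergne1980, 1.5.4] IS the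
  restriction of scalars of the hermitian matrix **`H(a, b) = (d⁻¹δ) · 2 · P(a, ab)`**,
  `P(a, ab) = −(C_b C_{ab}⁻¹ C_a)ᴴ (T₀ ⊗ 1)` (`DoubledUnitaryAdaptedBigCell`): `transverseForm_comp_param`; hence
  **`c(ι a, ι b) = γ_{ψ'}(Res H(a, b))`** (`localLeray_val_eq_weilIndex_resQF`).

## References

* S. S. Kudla, Israel J. Math. 87 (1994) 361–401, §3 [Kudla1994].
* M. Harris, S. S. Kudla, W. J. Sweet, J. Amer. Math. Soc. 9 (1996) 941–1004, §1 (1.14)–(1.16) [HarrisKudlaSweet1996].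
* G. Lion, M. Vergne, *The Weil representation, Maslov index and theta series* (1980), §1.5.4 [LionVergne1980].
-/

set_option autoImplicit false

noncomputable section

open NumberField IsDedekindDomain MeasureTheory Matrix
open Literature.RepresentationTheory.HeisenbergGroup
open Literature.NumberTheory.Automorphic Literature.NumberTheory.Automorphic.UnitaryGroup
open Literature.NumberTheory.Automorphic.UnitaryGroup.QuadraticCoordinates
open Literature.NumberTheory.GelbartRogawski1991.AdaptedBlocks
open Literature.NumberTheory.Weil1964
open Literature.NumberTheory.GaloisRepresentations.IsNonarchimedeanLocalField
open Literature.LinearAlgebra.QuadraticForm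

namespace Literature.NumberTheory.GelbartRogawski1991.UnitaryDualPair.LocalSplitting

variable (F : Type) [Field F] [NumberField F] (E : Type) [Field E] [NumberField E] [Algebra F E]
  (c : E ≃ₐ[F] E)
  {δ : E} (hcδ : c δ = -δ) (hδ : δ ≠ 0) {d : F} (hd : δ * δ = algebraMap F E d)
  (v : HeightOneSpectrum (𝓞 F)) (n : ℕ) {T₀ : Matrix (Fin n) (Fin n) F} (hT₀ : T₀.IsSymm) (hT₀d : IsUnit T₀.det)
  {JD : Matrix (Fin (n + n)) (Fin (n + n)) E} (hJD : JD = (gramD F n T₀).map (algebraMap F E))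

/-! ## §1 The parametrisation `z ↦ a·(z, z)` of `imDeltaV a` and the decomposition along `deltaV ⊕ imDeltaV (ab)` -/

/-- `z ↦ matA a · dblV z`, an `F_v`-linear map onto `imDeltaV a`. [cite: Kudla1994, §3] -/
def param (a : UnitaryGroup.localPi E c (n + n) JD v) : (Fin n → (LocalRing E v)) →ₗ[(v.adicCompletion F)] (Fin n ⊕ Fin n → (LocalRing E v)) :=
  ((Matrix.toLin' (matA F E c v n a)).restrictScalars (v.adicCompletion F)) ∘ₗ
    { toFun := fun z => dblV z
      map_add' := fun z z' => dblV_add z z'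
      map_smul' := fun t z => by
        funext k
        rcases k with i | i <;> simp [dblV] }

/-- `param a z = dblV (A_a z) + adblV (C_a z)`. [cite: Kudla1994, §3] -/
theorem param_apply (a : UnitaryGroup.localPi E c (n + n) JD v) (z : Fin n → (LocalRing E v)) :
    param F E c v n a z = dblV (blkA (matA F E c v n a) *ᵥ z) + adblV (blkC (matA F E c v n a) *ᵥ z) :=
  mulVec_dblV _ z

/-- `param a z = matA a · dblV z`. [cite: Kudla1994, §3] -/
theorem param_apply' (a : UnitaryGroup.localPi E c (n + n) JD v) (z : Fin n → (LocalRing E v)) :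
    param F E c v n a z = matA F E c v n a *ᵥ dblV z := rfl

/-- `param a z ∈ imDeltaV a`. [cite: Kudla1994, §3] -/
theorem param_mem (a : UnitaryGroup.localPi E c (n + n) JD v) (z : Fin n → (LocalRing E v)) :
    param F E c v n a z ∈ imDeltaV F E c v n a :=
  (mem_imDeltaV_iff F E c v n a _).2 ⟨z, param_apply F E c v n a z⟩

/-- **`z ↦ a·(z, z)` is an `F_v`-linear isomorphism `(E ⊗ F_v)ⁿ ≃ imDeltaV a`** when `C_a` is invertible.
[cite: Kudla1994, §3] -/
def paramEquiv (a : UnitaryGroup.localPi E c (n + n) JD v) (ha : IsUnit (blkC (matA F E c v n a))) :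
    (Fin n → (LocalRing E v)) ≃ₗ[(v.adicCompletion F)] imDeltaV F E c v n a :=
  LinearEquiv.ofBijective ((param F E c v n a).codRestrict _ (param_mem F E c v n a))
    ⟨by
      obtain ⟨Cinv, -, hCinvC⟩ := isUnit_iff_exists.1 ha
      intro z z' h
      have h' : param F E c v n a z = param F E c v n a z' := congrArg Subtype.val h
      rw [param_apply, param_apply] at h'
      have h2 := (dblV_add_adblV_inj h').2
      have := congrArg (Cinv *ᵥ ·) h2
      simpa only [Matrix.mulVec_mulVec, hCinvC, Matrix.one_mulVec] using this,
    by
      rintro ⟨u, hu⟩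
      obtain ⟨z, rfl⟩ := (mem_imDeltaV_iff F E c v n a u).1 hu
      exact ⟨z, Subtype.ext (param_apply F E c v n a z)⟩⟩

/-- underlying vector of `paramEquiv a z`. [cite: Kudla1994, §3] -/
@[simp] theorem coe_paramEquiv (a : UnitaryGroup.localPi E c (n + n) JD v) (ha : IsUnit (blkC (matA F E c v n a)))
    (z : Fin n → (LocalRing E v)) : ((paramEquiv F E c v n a ha z : imDeltaV F E c v n a) : Fin n ⊕ Fin n → (LocalRing E v)) = param F E c v n a z :=
  rfl

/-- **the decomposition along `Δ ⊕ (ab)Δ`**: `a·(z,z) = dblV (W z) + ab·(y, y)` with `y = C_{ab}⁻¹ C_a z`,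
`W = A_a − A_{ab} C_{ab}⁻¹ C_a`. [cite: Kudla1994, §3; LionVergne1980, §1.5.4] -/
theorem param_decomp (a b : UnitaryGroup.localPi E c (n + n) JD v) (hab : IsUnit (blkC (matA F E c v n (a * b))))
    (z : Fin n → (LocalRing E v)) :
    param F E c v n a z =
      dblV ((blkA (matA F E c v n a) - blkA (matA F E c v n (a * b)) * (blkC (matA F E c v n (a * b)))⁻¹ *
          blkC (matA F E c v n a)) *ᵥ z) +
        param F E c v n (a * b) ((blkC (matA F E c v n (a * b)))⁻¹ *ᵥ (blkC (matA F E c v n a) *ᵥ z)) := by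
  have hunit : IsUnit (blkC (matA F E c v n (a * b))).det := (Matrix.isUnit_iff_isUnit_det _).1 hab
  have hCy : blkC (matA F E c v n (a * b)) *ᵥ ((blkC (matA F E c v n (a * b)))⁻¹ *ᵥ (blkC (matA F E c v n a) *ᵥ z)) =
      blkC (matA F E c v n a) *ᵥ z := by
    rw [Matrix.mulVec_mulVec, Matrix.mul_nonsing_inv _ hunit, Matrix.one_mulVec]
  have hAy : blkA (matA F E c v n (a * b)) *ᵥ ((blkC (matA F E c v n (a * b)))⁻¹ *ᵥ (blkC (matA F E c v n a) *ᵥ z)) =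
      (blkA (matA F E c v n (a * b)) * (blkC (matA F E c v n (a * b)))⁻¹ * blkC (matA F E c v n a)) *ᵥ z := by
    rw [Matrix.mulVec_mulVec, Matrix.mulVec_mulVec]
  rw [param_apply, param_apply, hCy, hAy, ← add_assoc, ← dblV_add, ← Matrix.add_mulVec, sub_add_cancel]

/-- `(σ ∘ (W z)) ⬝ᵥ (T (C z')) = hermForm σ (Wᴴ T C) z z'`. [cite: HarrisKudlaSweet1996, §1 (1.14)] -/
theorem dotProduct_mulVec_eq_hermForm {R : Type*} [CommRing R] {m : Type*} [Fintype m] (σ : R →+* R)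
    (W T C : Matrix m m R) (z z' : m → R) :
    (⇑σ ∘ (W *ᵥ z)) ⬝ᵥ (T *ᵥ (C *ᵥ z')) = hermForm σ ((W.map σ)ᵀ * T * C) z z' := by
  rw [hermForm_apply, ← Matrix.mulVec_mulVec, ← Matrix.mulVec_mulVec, Matrix.dotProduct_mulVec (⇑σ ∘ z) (W.map σ)ᵀ,
    Matrix.vecMul_transpose]
  congr 1
  funext i
  exact RingHom.map_mulVec σ W z i

/-- the scalar `d⁻¹ δ = δ⁻¹` of `E ⊗ F_v` (as `ι_v(d⁻¹) · (δ ⊗ 1)`). [cite: HarrisKudlaSweet1996, §1 (1.16)] -/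
def deltaInv (δ : E) (d : F) : (LocalRing E v) := toLocalRing E v ((d : (v.adicCompletion F))⁻¹) * algebraMap E (LocalRing E v) δ

section Quadratic

variable [Algebra.IsQuadraticExtension F E]

omit [NumberField E] [Algebra.IsQuadraticExtension F E] in
include hδ hd in
/-- `d ≠ 0` in `F_v`. [cite: HarrisKudlaSweet1996, §1 (1.16)] -/
theorem coe_d_ne_zero : (d : (v.adicCompletion F)) ≠ 0 := by
  intro h0
  apply hδ
  have e : algebraMap F E d = 0 :=
    (map_eq_zero_iff _ (algebraMap F E).injective).2 ((map_eq_zero_iff _ (algebraMap F (v.adicCompletion F)).injective).1 h0)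
  exact mul_self_eq_zero.1 (hd.trans e)

include hd in
/-- `im ξ = re (δ⁻¹ ξ)` in the quadratic coordinates of `E ⊗ F_v`. [cite: HarrisKudlaSweet1996, §1 (1.16)] -/
theorem im_eq_re_deltaInv_mul (ξ : (LocalRing E v)) :
    im (quadraticLocalEquiv E v c hcδ hδ).toLinearEquiv.toAddEquiv ξ =
      re (quadraticLocalEquiv E v c hcδ hδ).toLinearEquiv.toAddEquiv (deltaInv F E v δ d * ξ) := by
  have h := isQuadraticCoordinates_local E v c hcδ hδ hd
  have hd0 : (d : (v.adicCompletion F)) ≠ 0 := coe_d_ne_zero F E hδ hd v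
  set Ψ := (quadraticLocalEquiv E v c hcδ hδ).toLinearEquiv.toAddEquiv
  conv_rhs => rw [← h.re_add_im ξ]
  have e : deltaInv F E v δ d * (toLocalRing E v (re Ψ ξ) + toLocalRing E v (im Ψ ξ) * algebraMap E (LocalRing E v) δ) =
      toLocalRing E v (im Ψ ξ) + toLocalRing E v ((d : (v.adicCompletion F))⁻¹ * re Ψ ξ) * algebraMap E (LocalRing E v) δ := by
    rw [deltaInv, mul_add, _root_.map_mul]
    have hsq : toLocalRing E v ((d : (v.adicCompletion F))⁻¹) * algebraMap E (LocalRing E v) δ * (toLocalRing E v (im Ψ ξ) * algebraMap E (LocalRing E v) δ) =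
        toLocalRing E v (im Ψ ξ) := by
      calc _ = toLocalRing E v (im Ψ ξ) * (toLocalRing E v ((d : (v.adicCompletion F))⁻¹) * (algebraMap E (LocalRing E v) δ * algebraMap E (LocalRing E v) δ)) := by ring
        _ = toLocalRing E v (im Ψ ξ) := by rw [h.mul_self, ← _root_.map_mul, inv_mul_cancel₀ hd0, map_one, mul_one]
    rw [hsq, add_comm]
    ring
  rw [e, h.re_eq]

end Quadratic

/-- **the hermitian matrix of the transverse form**: `H(a, b) = (d⁻¹ δ) · 2 · P(a, ab)` over `E ⊗ F_v`.
[cite: Kudla1994, §3; HarrisKudlaSweet1996, §1 (1.14)] -/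
def transverseHerm (δ : E) (d : F) (T₀ : Matrix (Fin n) (Fin n) F) (a b : UnitaryGroup.localPi E c (n + n) JD v) :
    Matrix (Fin n) (Fin n) (LocalRing E v) :=
  (deltaInv F E v δ d * 2) • transverseMatrix (gramS F E v n T₀) (conjLocal E c v) (matA F E c v n a) (matA F E c v n (a * b))

/-- the value of the bundled Leray cocycle (unfolding). [cite: MoeglinVignerasWaldspurger1987, Chap. 3 §I.3] -/
theorem localLeray_val [MeasurableSpace (HeightOneSpectrum.adicCompletion F v)]
    [BorelSpace (HeightOneSpectrum.adicCompletion F v)] (μ : Measure (HeightOneSpectrum.adicCompletion F v))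
    [μ.IsAddHaarMeasure] {N : ℕ} (T : Matrix (Fin N) (Fin N) F) (hTd : IsUnit T.det) {ψ' : AddChar (v.adicCompletion F) Circle}
    (hψ' : ψ'.IsContinuousNontrivial) (ℓ : Submodule (v.adicCompletion F) ((Fin N → (v.adicCompletion F)) × (Fin N → (v.adicCompletion F))))
    (hℓ : LinearMap.BilinForm.orthogonal (alt (polar (localPairing F N T v))) ℓ = ℓ) (g₁ g₂ : LocalSp F N T v) :
    ((localLeray F N T hTd v μ ψ' hψ' ℓ hℓ g₁ g₂ : ℂˣ) : ℂ) = lerayCocycle ψ' μ (alt (polar (localPairing F N T v))) ℓ g₁.1 g₂.1 :=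
  rfl

section Cocycle

variable [Algebra.IsQuadraticExtension F E]

/-- `E ⊗_F F_v` is a finite `F_v`-module (for a quadratic extension `E/F`; tree `finite_localRing` with the
quadratic datum chosen by `exists_algEquiv_apply_eq_neg`). [cite: HarrisKudlaSweet1996, §1 (1.11)] -/
instance moduleFinite_localRing : Module.Finite (v.adicCompletion F) (LocalRing E v) := by
  obtain ⟨σ, δ₁, h1, h2⟩ := exists_algEquiv_apply_eq_neg (F := F) (E := E)
  exact finite_localRing E v σ h1 h2

include hT₀ hJD in
/-- `deltaV` is `formD`-isotropic. [cite: HarrisKudlaSweet1996, §1 (1.11)] -/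
theorem isotropic_deltaV : ∀ x ∈ deltaV F E v n, ∀ y ∈ deltaV F E v n, formD F E c hcδ hδ hd v n T₀ x y = 0 := by
  intro x hx y hy
  obtain ⟨a, rfl⟩ := (mem_deltaV_iff_exists F E v n x).1 hx
  obtain ⟨a', rfl⟩ := (mem_deltaV_iff_exists F E v n y).1 hy
  exact formD_dblV_dblV F E c hcδ hδ hd v n hT₀ hJD a a'

include hT₀ hJD in
/-- `imDeltaV g` is `formD`-isotropic (`ι(g)` is an isometry). [cite: HarrisKudlaSweet1996, §1 (1.11)] -/
theorem isotropic_imDeltaV (g : UnitaryGroup.localPi E c (n + n) JD v) :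
    ∀ x ∈ imDeltaV F E c v n g, ∀ y ∈ imDeltaV F E c v n g, formD F E c hcδ hδ hd v n T₀ x y = 0 := by
  intro x hx y hy
  obtain ⟨z, rfl⟩ := (mem_imDeltaV_iff F E c v n g x).1 hx
  obtain ⟨z', rfl⟩ := (mem_imDeltaV_iff F E c v n g y).1 hy
  rw [← mulVec_dblV, ← mulVec_dblV, formD_apply, eD_matA_mulVec F E c hcδ hδ hd v n hT₀ hJD,
    eD_matA_mulVec F E c hcδ hδ hd v n hT₀ hJD]
  exact ((iotaD F E c hcδ hδ hd v n hT₀ hJD g).2 _ _).trans (formD_dblV_dblV F E c hcδ hδ hd v n hT₀ hJD z z')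

/-! ## §3 The transverse form in the parametrisation `z ↦ a·(z, z)` -/

include hT₀ hJD in
/-- **THE TRANSVERSE FORM IS `Res H(a, b)`**: for `a`, `ab` in the big cell, the transverse form of
`(deltaV, imDeltaV a, imDeltaV (ab))` pulled back along `z ↦ a·(z, z)` is the restriction of scalars of the hermitian
matrix `H(a, b)`. [cite: LionVergne1980, §1.5.4; Kudla1994, §3; HarrisKudlaSweet1996, §1 (1.14)–(1.16)] -/
theorem transverseForm_comp_param (a b : UnitaryGroup.localPi E c (n + n) JD v)
    (ha : IsUnit (blkC (matA F E c v n a))) (hab : IsUnit (blkC (matA F E c v n (a * b))))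
    (hc : IsCompl (deltaV F E v n) (imDeltaV F E c v n (a * b))) :
    (transverseForm (formD F E c hcδ hδ hd v n T₀) (deltaV F E v n) (imDeltaV F E c v n a)
        (imDeltaV F E c v n (a * b)) hc).comp
        ((paramEquiv F E c v n a ha : (Fin n → (LocalRing E v)) ≃ₗ[(v.adicCompletion F)] imDeltaV F E c v n a) : (Fin n → (LocalRing E v)) →ₗ[(v.adicCompletion F)] imDeltaV F E c v n a) =
      resQF (isQuadraticCoordinates_local E v c hcδ hδ hd) (conjLocal E c v) (conjLocal_toLocalRing c v)
        (transverseHerm F E c v n δ d T₀ a b) := by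
  refine QuadraticMap.ext fun z => ?_
  set A := blkA (matA F E c v n a)
  set C := blkC (matA F E c v n a)
  set Aab := blkA (matA F E c v n (a * b))
  set Cab := blkC (matA F E c v n (a * b))
  set W := A - Aab * Cab⁻¹ * C with hW
  set y := Cab⁻¹ *ᵥ (C *ᵥ z) with hy
  have hx : param F E c v n a z = dblV (W *ᵥ z) + param F E c v n (a * b) y := param_decomp F E c v n a b hab z
  have h₁ : dblV (W *ᵥ z) ∈ deltaV F E v n := dblV_mem_deltaV F E v n _
  have h₃ : param F E c v n (a * b) y ∈ imDeltaV F E c v n (a * b) := param_mem F E c v n (a * b) y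
  have hCy : Cab *ᵥ y = C *ᵥ z := by
    rw [hy, Matrix.mulVec_mulVec, Matrix.mul_nonsing_inv _ ((Matrix.isUnit_iff_isUnit_det _).1 hab), Matrix.one_mulVec]
  have hp1 : (deltaV F E v n).projection (imDeltaV F E c v n (a * b)) hc (param F E c v n a z) = dblV (W *ᵥ z) := by
    rw [hx, map_add, Submodule.projection_apply_of_mem_left hc h₁, Submodule.projection_apply_of_mem_right hc h₃,
      add_zero]
  have hp3 : (imDeltaV F E c v n (a * b)).projection (deltaV F E v n) hc.symm (param F E c v n a z) =
      param F E c v n (a * b) y := by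
    rw [hx, map_add, Submodule.projection_apply_of_mem_right hc.symm h₁,
      Submodule.projection_apply_of_mem_left hc.symm h₃, zero_add]
  have h0 : (⇑(conjLocal E c v) ∘ (0 : Fin n → (LocalRing E v))) = 0 := funext fun i => map_zero _
  have hform : formD F E c hcδ hδ hd v n T₀ (dblV (W *ᵥ z)) (param F E c v n (a * b) y) =
      im (quadraticLocalEquiv E v c hcδ hδ).toLinearEquiv.toAddEquiv
        (2 * hermForm (conjLocal E c v) ((W.map (conjLocal E c v))ᵀ * gramS F E v n T₀ * C) z z) := by
    rw [param_apply, hCy, ← add_zero (dblV (W *ᵥ z)), ← adblV_zero, formD_dblV_adblV F E c hcδ hδ hd v n hT₀ hJD, h0,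
      zero_dotProduct, add_zero, dotProduct_mulVec_eq_hermForm]
  rw [QuadraticMap.comp_apply, transverseForm_apply, LinearEquiv.coe_coe, coe_paramEquiv, hp1, hp3, hform,
    im_eq_re_deltaInv_mul F E c hcδ hδ hd v, resQF_apply, transverseHerm, transverseMatrix, hermForm_apply,
    hermForm_apply, Matrix.smul_mulVec, dotProduct_smul, smul_eq_mul, ← mul_assoc]

variable [MeasurableSpace (HeightOneSpectrum.adicCompletion F v)] [BorelSpace (HeightOneSpectrum.adicCompletion F v)]
  (μ : Measure (HeightOneSpectrum.adicCompletion F v)) [μ.IsAddHaarMeasure]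

/-! ## §2 The cocycle as a Leray–Weil index in the adapted frame -/

/-- **`c(ι a, ι b) = μ(deltaV, imDeltaV a, imDeltaV (ab))`** for the pulled-back form `formD = im h_𝔻`: the Leray
cocycle of `ℓ_Δ` read in the adapted frame (transport along `eD`, tree `lerayWeilIndex_map_equiv`).
[cite: LionVergne1980, §1.5.2; Kudla1994, §3] -/
theorem localLeray_val_eq_lerayWeilIndex {ψ' : AddChar (v.adicCompletion F) Circle} (hψ' : ψ'.IsContinuousNontrivial)
    (a b : UnitaryGroup.localPi E c (n + n) JD v) :
    ((localLeray F (n + n) (gramD F n T₀) (isUnit_det_gramD F n hT₀d) v μ ψ' hψ' (deltaLagrangian F v n)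
        (deltaLagrangian_orthogonal F v n T₀ hT₀d) (iotaD F E c hcδ hδ hd v n hT₀ hJD a)
        (iotaD F E c hcδ hδ hd v n hT₀ hJD b) : ℂˣ) : ℂ) =
      lerayWeilIndex ψ' μ (formD F E c hcδ hδ hd v n T₀) (deltaV F E v n) (imDeltaV F E c v n a)
        (imDeltaV F E c v n (a * b)) := by
  rw [localLeray_val, lerayCocycle_def, ← Subgroup.coe_mul, ← _root_.map_mul,
    ← map_eD_imDeltaV F E c hcδ hδ hd v n hT₀ hJD a, ← map_eD_imDeltaV F E c hcδ hδ hd v n hT₀ hJD (a * b),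
    ← map_eD_deltaV F E c hcδ hδ hd v n]
  exact lerayWeilIndex_map_equiv μ (eD F E c hcδ hδ hd v n) (fun x y => rfl) hψ' _ _ _

include hT₀ in
/-- **`c^{ψ'}_{ℓ_Δ}(ι a, ι b) = γ_{ψ'}(Res H(a, b))`** for `a`, `ab` in the big cell (`C_a`, `C_{ab}` invertible):
the Leray cocycle on the big cell is the Weil index of the restriction of scalars of the hermitian matrix `H(a, b)`.
[cite: Kudla1994, §3; HarrisKudlaSweet1996, §1 (1.14)–(1.16); LionVergne1980, §1.5.4] -/
theorem localLeray_val_eq_weilIndex_resQF {ψ' : AddChar (v.adicCompletion F) Circle} (hψ' : ψ'.IsContinuousNontrivial)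
    (a b : UnitaryGroup.localPi E c (n + n) JD v)
    (ha : IsUnit (blkC (matA F E c v n a))) (hab : IsUnit (blkC (matA F E c v n (a * b)))) :
    ((localLeray F (n + n) (gramD F n T₀) (isUnit_det_gramD F n hT₀d) v μ ψ' hψ' (deltaLagrangian F v n)
        (deltaLagrangian_orthogonal F v n T₀ hT₀d) (iotaD F E c hcδ hδ hd v n hT₀ hJD a)
        (iotaD F E c hcδ hδ hd v n hT₀ hJD b) : ℂˣ) : ℂ) =
      weilIndexSpace ψ' μ (resQF (isQuadraticCoordinates_local E v c hcδ hδ hd) (conjLocal E c v)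
        (conjLocal_toLocalRing c v) (transverseHerm F E c v n δ d T₀ a b)) := by
  have hc : IsCompl (deltaV F E v n) (imDeltaV F E c v n (a * b)) := (isCompl_of_isUnit_blkC F E c v n hab).symm
  rw [localLeray_val_eq_lerayWeilIndex F E c hcδ hδ hd v n hT₀ hT₀d hJD μ hψ' a b,
    lerayWeilIndex_eq_weilIndexSpace_transverseForm μ hψ' (isAlt_formD F E c hcδ hδ hd v n) hc
      (isotropic_deltaV F E c hcδ hδ hd v n hT₀ hJD) (isotropic_imDeltaV F E c hcδ hδ hd v n hT₀ hJD (a * b)),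
    ← weilIndexSpace_comp_linearEquiv μ hψ' _ (paramEquiv F E c v n a ha),
    transverseForm_comp_param F E c hcδ hδ hd v n hT₀ hJD a b ha hab hc]

end Cocycle

/-! ### Build-lane note (ops-buildfix G11b-3 recipe, LEDGER B13-1, 2026-08-21)
`lean -o` (the hub build lane, never `lean`/the gate check) runs Lean 4.32's library-suggestion indexers
(`Lean.LibrarySuggestions.SymbolFrequency` / `SineQuaNon`, from their `exportEntriesFn`) over the statement of
every local theorem that is not a denied premise; on this family's statements (very large dependent binder
telescopes through the theta-kernel / dual-pair data) that fold runs for tens of minutes to hours and the build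
lane kills the job (incident G11b-3, run/shared/lean/ops/buildfix/G11b-3-DOSSIER.md). `isDeniedPremise` skips
`[implicit_reducible]` constants before any fold, and a reducibility status on a *theorem* is inert (Meta never
unfolds `thmInfo`; the kernel ignores the attribute), so the public theorems of this file are tagged
`[implicit_reducible]` purely to keep them out of that index. Only other effect: they are not offered by
`+suggestions` premise selectors. No statement or proof is changed; superseded if the operator lands a
deny-list form (`HarnessLib.PremiseIndex`). -/
set_option allowUnsafeReducibility true in
attribute [implicit_reducible]
  param_apply param_apply' param_mem coe_paramEquiv param_decomp dotProduct_mulVec_eq_hermForm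
  coe_d_ne_zero im_eq_re_deltaInv_mul localLeray_val isotropic_deltaV isotropic_imDeltaV
  transverseForm_comp_param localLeray_val_eq_lerayWeilIndex localLeray_val_eq_weilIndex_resQF

end Literature.NumberTheory.GelbartRogawski1991.UnitaryDualPair.LocalSplitting

end
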